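import Mathlib

/-!
# Crux `FeketeSOS.CharPSparseSOS` (stmt-ValiantsHypothesis-14989), line `Sketch` — stub `stub_dictionaryAtZero`

Dictionary at the lower cusp.  For a field `K` of characteristic `p` and `P ∈ K[X]`, the coefficient
function `n ↦ P_n` (`n < p`) is interpolated by `I(U) = Σ_{n<p} P_n · (1 − (U − n)^{p−1})`.  By the
binomial theorem the coefficient of `U^d` in `I`, for `d ≥ 1`, is
`−binom(p−1, d)·(−1)^{p−1−d} · Σ_{n<p} P_n n^{p−1−d}` (`coeff_interp_of_one_le`), and the constant
coefficient is `P_0` (`coeff_interp_zero`, Fermat: `(−n)^{p−1} = 1` for `0 < n < p`, `0^{p−1} = 0`).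
Since `binom(p−1, d)` is a unit mod `p` for `d ≤ p − 1` (`p ∤ (p−1)!`), `X^D ∣ I` — i.e. the
coefficients `0, …, D−1` of `I` vanish (`Polynomial.X_pow_dvd_iff`) — is equivalent, for `D ≤ p − 1`,
to `(1 ≤ D → P_0 = 0) ∧ ∀ 1 ≤ d < D, Σ_{n<p} P_n n^{p−1−d} = 0`.
-/

-- `Summit.ValiantsHypothesis.ValiantsHypothesis.…` is the tree's mandated single-conjunct layout (Sub = Summit).
set_option linter.dupNamespace false

namespace Summit.ValiantsHypothesis.ValiantsHypothesis.Theorems.CharPSparseSOSTwoCusp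

open Polynomial Finset

/-- Coefficients of the interpolant above degree `0`: for `1 ≤ i`,
`[U^i] Σ_{n<p} c(n)(1 − (U − n)^{p−1}) = −binom(p−1, i)·(−1)^{p−1−i} · Σ_{n<p} c(n) n^{p−1−i}`
(any commutative ring; the binomial theorem `Polynomial.coeff_X_add_C_pow`). -/
theorem coeff_interp_of_one_le {R : Type*} [CommRing R] (p : ℕ) (c : ℕ → R) (i : ℕ) (hi : 1 ≤ i) :
    (∑ n ∈ range p, C (c n) * (1 - (X - C (n : R)) ^ (p - 1))).coeff i =
      -(((p - 1).choose i : R) * (-1) ^ (p - 1 - i)) * ∑ n ∈ range p, c n * (n : R) ^ (p - 1 - i) := by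
  -- adapted from Theorems/FeketeNoSparseSplit/Negative/LegendreExtremiser.lean (`coeff_interp`, over `ZMod p`)
  rw [finsetSum_coeff, Finset.mul_sum]
  refine Finset.sum_congr rfl fun m _ => ?_
  rw [mul_sub, mul_one, coeff_sub, coeff_C, if_neg (by omega), zero_sub, coeff_C_mul,
    show (X - C (m : R)) = X + C (-(m : R)) by rw [map_neg, sub_eq_add_neg], coeff_X_add_C_pow,
    neg_pow]
  ring

/-- Fermat's little theorem transported to a field of characteristic `p`: a nonzero element of the
prime field `ZMod p`, read in `K`, has `(p−1)`-st power `1`. -/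
theorem castHom_pow_sub_one (K : Type) [Field K] (p : ℕ) [Fact p.Prime] [CharP K p]
    (a : ZMod p) (ha : a ≠ 0) : (ZMod.castHom (dvd_refl p) K a) ^ (p - 1) = 1 := by
  rw [← map_pow, ZMod.pow_card_sub_one_eq_one ha, map_one]

/-- Fermat for `0 < n < p` in a field of characteristic `p`: `(−n)^{p−1} = 1`. -/
theorem neg_natCast_pow_sub_one (K : Type) [Field K] (p : ℕ) [Fact p.Prime] [CharP K p]
    (n : ℕ) (hn0 : n ≠ 0) (hnp : n < p) : (-(n : K)) ^ (p - 1) = 1 := by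
  have hne : (-(n : ZMod p)) ≠ 0 := by
    rw [Ne, neg_eq_zero, ZMod.natCast_eq_zero_iff]
    exact Nat.not_dvd_of_pos_of_lt (Nat.pos_of_ne_zero hn0) hnp
  have h := castHom_pow_sub_one K p _ hne
  rwa [map_neg, map_natCast] at h

/-- The constant coefficient of the interpolant is `c 0`:
`[U^0] Σ_{n<p} c(n)(1 − (U − n)^{p−1}) = Σ_{n<p} c(n)(1 − (−n)^{p−1}) = c(0)` by Fermat. -/
theorem coeff_interp_zero (K : Type) [Field K] (p : ℕ) [Fact p.Prime] [CharP K p] (c : ℕ → K) :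
    (∑ n ∈ range p, C (c n) * (1 - (X - C (n : K)) ^ (p - 1))).coeff 0 = c 0 := by
  have hprime : p.Prime := Fact.out
  have hp1 : p - 1 ≠ 0 := by have := hprime.two_le; omega
  have hcoeff : ∀ n : ℕ, ((1 - (X - C (n : K)) ^ (p - 1)) : K[X]).coeff 0 = 1 - (-(n : K)) ^ (p - 1) := by
    intro n
    rw [coeff_sub, coeff_one_zero,
      show (X - C (n : K)) = X + C (-(n : K)) by rw [map_neg, sub_eq_add_neg], coeff_X_add_C_pow,
      Nat.sub_zero, Nat.choose_zero_right, Nat.cast_one, mul_one]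
  rw [finsetSum_coeff, Finset.sum_eq_single 0]
  · rw [coeff_C_mul, hcoeff, Nat.cast_zero, neg_zero, zero_pow hp1, sub_zero, mul_one]
  · intro n hn hne
    rw [coeff_C_mul, hcoeff, neg_natCast_pow_sub_one K p n hne (mem_range.mp hn), sub_self, mul_zero]
  · intro h
    exact absurd (mem_range.mpr hprime.pos) h

/-- `binom(p−1, d)` is nonzero in characteristic `p` for `d ≤ p − 1` (it divides `(p−1)!`, and `p ∤ (p−1)!`). -/
theorem choose_sub_one_cast_ne_zero (K : Type) [Field K] (p : ℕ) [Fact p.Prime] [CharP K p]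
    (d : ℕ) (hd : d ≤ p - 1) : ((p - 1).choose d : K) ≠ 0 := by
  have hprime : p.Prime := Fact.out
  rw [Ne, CharP.cast_eq_zero_iff K p]
  intro hdvd
  have hfac : p ∣ (p - 1).factorial := by
    rw [← Nat.choose_mul_factorial_mul_factorial hd]
    exact (hdvd.mul_right _).mul_right _
  have := (hprime.dvd_factorial).mp hfac
  have := hprime.two_le
  omega

/-- **Dictionary at the lower cusp.**  For a field `K` of characteristic `p`, `P ∈ K[X]` of degree
`< p` and `D ≤ p − 1`: the interpolant `I = Σ_{n<p} P_n (1 − (X − n)^{p−1})` of the coefficient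
function is divisible by `X^D` iff `(1 ≤ D → P_0 = 0)` and the twisted power sums
`Σ_{n<p} P_n n^{p−1−d}` vanish for `1 ≤ d < D`. [folklore] -/
theorem stub_dictionaryAtZero :
    ∀ (K : Type) [Field K] (p : ℕ) [Fact p.Prime] [CharP K p] (P : K[X]) (D : ℕ),
      P.natDegree < p → D ≤ p - 1 →
        (((1 ≤ D → P.coeff 0 = 0) ∧
            ∀ d : ℕ, 1 ≤ d → d < D → ∑ n ∈ Finset.range p, P.coeff n * (n : K) ^ (p - 1 - d) = 0) ↔
          (X : K[X]) ^ D ∣ ∑ n ∈ Finset.range p, C (P.coeff n) * (1 - (X - C (n : K)) ^ (p - 1))) := by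
  intro K _ p _ _ P D _ hD
  rw [X_pow_dvd_iff]
  constructor
  · rintro ⟨h0, hmom⟩ d hdD
    rcases Nat.eq_zero_or_pos d with rfl | hdpos
    · rw [coeff_interp_zero]
      exact h0 (by omega)
    · rw [coeff_interp_of_one_le p _ d hdpos, hmom d hdpos hdD, mul_zero]
  · intro h
    refine ⟨fun hD1 => ?_, fun d hd1 hdD => ?_⟩
    · have h0 := h 0 (by omega)
      rwa [coeff_interp_zero] at h0
    · have hd := h d hdD
      rw [coeff_interp_of_one_le p _ d hd1] at hd
      rcases mul_eq_zero.mp hd with h1 | h1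
      · exfalso
        rw [neg_eq_zero, mul_eq_zero] at h1
        rcases h1 with h1 | h1
        · exact choose_sub_one_cast_ne_zero K p d (by omega) h1
        · exact pow_ne_zero _ (neg_ne_zero.mpr one_ne_zero) h1
      · exact h1

end Summit.ValiantsHypothesis.ValiantsHypothesis.Theorems.CharPSparseSOSTwoCusp
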